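import Summits.BirchSwinnertonDyer.BirchSwinnertonDyer.Theses.SemiOrdinaryEisensteinDescent
import Summits.BirchSwinnertonDyer.BirchSwinnertonDyer.Theorems.UniversalToricDescentWildSplitControlAtThreeOfPoitouTate
import Summits.BirchSwinnertonDyer.BirchSwinnertonDyer.Theorems.SchneiderFreeAdditiveX3PoitouTateSelmerDualityHolds
import Summits.BirchSwinnertonDyer.BirchSwinnertonDyer.Theorems.ThetaPartnerAtTwoSignedControlAtTwoStubPoitouTateShaRat
import HarnessLib

/-!
# Crux C `WildSplitControlAtThree` (item stmt-BirchSwinnertonDyer-20386) PROVED — on both routes that state it,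
# `UniversalToricDescent` (crux #5) and `SemiOrdinaryEisensteinDescent` (aside, rank 5)

Cell `pub/bsd-wall`, width seat `bsd-wall-soed-p1-w3` g17 (SOED E-lineage), 2026-08-28. THEOREMS ONLY; nothing re-derived.

WHAT. Jetchev–Skinner–Wan's anticyclotomic control count at a potentially supersingular SPLIT 3 on the onto wild rank-one
cell — the tree's additive currency `SchneiderFree.AdditiveControlOnTreeAt 3` at every anticyclotomic frame of every
Heegner datum (item 20386's text, identical on both routes by dedup) — is now an UNCONDITIONAL theorem of the tree.
Gen 17 of `bsd-potss-kmc` reduced it to SEVEN named facts (`wildSplitControlAtThree_of_facts_of_serre1967`); `bsd-wall-utd-p3`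
g5 discharged five of them (Euler–Poincaré, `cd ≤ 2`, Brink Thm 2 / Cor 1, Serre 1967 §5 Prop. 8), leaving
`UniversalToricDescentControl.wildSplitControlAtThree_of_poitouTate (hPT) (hPT2)` conditional on exactly the two Poitou–Tate
facts. Both are THEOREMS of the tree since 2026-08-28:
* PT1 — Poitou–Tate duality for Selmer structures over every number field:
  `SchneiderFreeAdditiveX3.PoitouTateReduction.poitouTate_selmerStructure_duality_holds` (cell bsd-schneider, p624636;
  items 20461 / 23092 CLOSED·proved);
* PT2 — `Ш¹(K, M^D)` and `Ш²(K, M)` are finite and perfectly paired for every number field and every finite module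
  (Milne ADT I Thm. 4.10 (a)): `SignedEC.PoitouTateShaRat.poitouTate_sha_tateDual_numberField` (p629917; cells
  bsd-schneider door-c4/door-c5 + bsd-inputs k4-p1 + bsd-line-chl-p2: the Ш²-readout road, bridge (nat, R4=) + (A)).
Substituting them closes item 20386 on both routes (`universalToricDescent_wildSplitControlAtThree_proof`,
`semiOrdinaryEisensteinDescent_wildSplitControlAtThree_proof`).

HONEST FRAMING: an unconditional theorem about the CONTROL side only (the exact count
`n = ord₃#Ш(E/K)[3^∞] + 2·(ord₃ log_ω P − ord₃[E(K):ℤP]) + ord₃ ∏_{w split} c_w` for the characteristic power series at 𝟙,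
GIVEN Kolyvagin's finiteness as the item's own antecedent). It is neither half of BSD₃: the Eisenstein crux E_𝟙^V (26610)
and the rank-zero twin Z (20387) of `SemiOrdinaryEisensteinDescent`, and UTD's ♭-cruxes, stay OPEN. The Birch–Swinnerton-Dyer
conjecture is NOT proved for any curve by this file.

References: [JetchevSkinnerWan2017] Thm. 3.3.1, Prop. 3.3.4 (arXiv:1512.06894 pp. 11–13); [MilneADT2006] I Thm. 2.8, 4.10;
[Brink2007] Thm. 2, Cor. 1; [Serre1967GroupesPDivisibles] §5 Prop. 8; [Greenberg1999LNM] §4.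
-/

noncomputable section

set_option linter.dupNamespace false -- `…BirchSwinnertonDyer.BirchSwinnertonDyer…` is the cell's nested layout (D-0017)
set_option autoImplicit false

namespace Summit.BirchSwinnertonDyer.BirchSwinnertonDyer.Theorems.UniversalToricDescentControl

/-- **Item 20386 on route `UniversalToricDescent` — crux #5 `WildSplitControlAtThree` PROVED (by name):** the anticyclotomic
control count at the wild split 3, `UniversalToricDescentControl.wildSplitControlAtThree_of_poitouTate` with its two Poitou–Tate
hypotheses supplied by the tree theorems `poitouTate_selmerStructure_duality_holds` (PT1) and
`poitouTate_sha_tateDual_numberField` (PT2). Unconditional; BSD is not proved by this.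
[cite: JetchevSkinnerWan2017, Thm. 3.3.1, Prop. 3.3.4 (arXiv:1512.06894 pp. 11–13)] [cite: MilneADT2006, Ch. I, Thm. 4.10 (a)(b), Thm. 2.8] -/
theorem universalToricDescent_wildSplitControlAtThree_proof :
    Summit.BirchSwinnertonDyer.BirchSwinnertonDyer.Theses.UniversalToricDescent.WildSplitControlAtThree :=
  wildSplitControlAtThree_of_poitouTate
    (fun K _ _ => SchneiderFreeAdditiveX3.PoitouTateReduction.poitouTate_selmerStructure_duality_holds K)
    SignedEC.PoitouTateShaRat.poitouTate_sha_tateDual_numberField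

/-- **Item 20386 on route `SemiOrdinaryEisensteinDescent` — the same item (one item by dedup; aside, rank 5), crux C
`WildSplitControlAtThree` PROVED (by name):** the route's text unfolds to UTD's verbatim, so the UTD theorem is the proof.
Unconditional; BSD is not proved by this.
[cite: JetchevSkinnerWan2017, Thm. 3.3.1, Prop. 3.3.4 (arXiv:1512.06894 pp. 11–13)] [cite: MilneADT2006, Ch. I, Thm. 4.10 (a)(b), Thm. 2.8] -/
theorem semiOrdinaryEisensteinDescent_wildSplitControlAtThree_proof :
    Summit.BirchSwinnertonDyer.BirchSwinnertonDyer.Theses.SemiOrdinaryEisensteinDescent.WildSplitControlAtThree := by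
  unfold Summit.BirchSwinnertonDyer.BirchSwinnertonDyer.Theses.SemiOrdinaryEisensteinDescent.WildSplitControlAtThree
  exact universalToricDescent_wildSplitControlAtThree_proof

end Summit.BirchSwinnertonDyer.BirchSwinnertonDyer.Theorems.UniversalToricDescentControl

end
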